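import Mathlib
import HarnessLib

/-!
# Crux K2 `PoloidalWindowRigidity` (stmt-NavierStokesRegularity-19708), line `z_shock` — R3 inhabitant census: ROTATING PATTERNS of the
# autonomous thick height-evolution (I) — the profile equation (kinematic entrance) and the a-priori ANGULAR FLATNESS of every rotating pattern

`--supports stmt-NavierStokesRegularity-19708 --as helper` (leafhand-ns-poloidalwindowdoor-3 g9, cell decomp-ns, 2026-08-31).  Class-free,
def-free, Mathlib only.  **No stub and no summit is closed by this file; Navier–Stokes regularity is NOT proved here (rung 0).**

WHY THIS FILE.  On an autonomous window the deciding stub `stub_zShockThickAut` of `Cruxes/PoloidalWindowRigidity/Lines/z_shock.lean` produces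
the scalar height-evolution `∂ₛ∂ₛW = Σᵢ ∂ᵢ(γ(W) ∂ᵢW)` on `ℝ_s × ℝ²_y` (tree `…ZShockSliceTyping.slice_wave_pde`; `γ = −G_w > 0` the squared
characteristic speed).  The standing repair census of the crux (hands 3-g6/3-g7/3-g8, exit reports 2026-08-31T16:00Z/16:47Z/17:34Z) lists, after
the planar (R2) and OBLIQUE drifting (R2½, `…ZShockObliqueProfile{,Plane}`) patterns, the ROTATING PATTERNS `W(s, y) = Ψ(R_{ωs} y)` — a fixed
planar pattern turning about a vertical axis at the angular rate `ω ≠ 0` as the height increases; unlike planar patterns they satisfy the stubs'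
twist clause generically — as the next inhabitant candidates of the autonomous column («rotating patterns [L]»; mechanism remark (b) of 3-g8:
outside the sonic circle `ω²|y|² = γ` the radius is time-like and the angle a periodic space variable).  This file supplies the coordinate-free
entrance facts such an analysis starts from, in the `(s, y)`-typing of the tree's height-evolution files (no polar chart and no definition is
introduced: the angular derivative is the vector field `Θ = Jy·∇`, `Jy = (−y₁, y₀)`, written as nested `fderiv`; the companion file
`…ZShockRotatingProfileLogPolar` adds the radius-as-time form and the radial dichotomy):

* coordinates on the plane (`fderiv_apply_coord`, `hasFDerivAt_coord_zero/one`, `proj_zero/one_apply`);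
* KINEMATICS OF ROTATION ORBITS (`hasDerivAt_rotOrbit`, `rotOrbit_zero`, `rotOrbit_add_two_pi`, `hasDerivAt_comp_rotOrbit`,
  `differentiable_angularDeriv`, `hasDerivAt_angularDeriv_comp_rotOrbit`, `deriv_deriv_comp_rotOrbit`): along the orbit `c(s) = R_{ωs} y` of a
  `C²` function `Ψ : ℝ² → ℝ`, `d/ds Ψ(c s) = ω (ΘΨ)(c s)` and `d²/ds² Ψ(c s) = ω² (ΘΘΨ)(c s)`, `ΘΨ(y) = DΨ(y)[Jy]`;
* ★ `rotating_slice_profile_equation` — **the profile equation.**  If the rotating pattern satisfies the slice equation at height `s = 0`, then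
  `Ψ` solves `ω² ΘΘΨ = Σᵢ ∂ᵢ(γ(Ψ) ∂ᵢΨ)` on the plane — a second-order equation of MIXED type (elliptic inside the sonic circle, hyperbolic
  with the radius time-like outside it);
* `periodic_deriv_abs_le` — a periodic `C²` function of one variable with `|f''| ≤ M` has `|f'| ≤ M·T` (`T` the period; Rolle + mean value);
* ★ `angularDeriv_abs_le` / `angularDeriv_abs_le_of_rotating` — **angular flatness.**  A `C²` function on the plane with `|ΘΘΨ| ≤ K` has
  `|ΘΨ(y)| = |DΨ(y)[Jy]| ≤ 2πK` at every `y` — although `|Jy| = |y|` is unbounded; for a solution of the profile equation whose divergence side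
  is bounded by `C` (true in the class: all slice derivatives are bounded) this gives `|DΨ(y)[Jy]| ≤ 2πC/ω²`: the tangential derivative of a
  rotating pattern decays like `|y|⁻¹`, and the angular datum `Ψ_θ` of the exterior radius-as-time problem is uniformly bounded.

Elementary (chain rule along circles, Rolle, MVT); it proves no rigidity: the exterior 1+1 genuinely nonlinear problem with periodic angle and
radius-dependent flux is the named open piece «rotating patterns [L]» of the census and is NOT treated here.  presearch: «rotating / spiral wave
solutions of a quasilinear wave equation, rigidity» — corpus hybrid + vsearch: only bifurcation theory of rotating waves (book:kielhofer2012
pp 309–329, book:haragus2010 p 251) and reaction–diffusion spirals (book:grindrod1991, book:desai2009); galaxy (substring «rotating wave|spiral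
characteristic|rigidly rotating», all stars): no relevant hit; nothing to cite beyond folklore calculus. [folklore]
-/

noncomputable section

namespace Summit.NavierStokesRegularity.NavierStokesRegularity.Theorems.PoloidalWindowDoorPoloidalWindowRigidityZShockRotatingProfile

-- the summit and its single sub-problem share the name (CONVENTIONS §1)
set_option linter.dupNamespace false

open Set Filter Topology Function

variable {Ψ : EuclideanSpace ℝ (Fin 2) → ℝ} {γ : ℝ → ℝ} {ω : ℝ} {y : EuclideanSpace ℝ (Fin 2)}
  {c : ℝ → EuclideanSpace ℝ (Fin 2)} {J : EuclideanSpace ℝ (Fin 2) → EuclideanSpace ℝ (Fin 2)}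

/-! ### Coordinates on the plane -/

/-- A (Fréchet) derivative applied to a vector, in coordinates: `DΨ(x)[h] = h₀ ∂₀Ψ(x) + h₁ ∂₁Ψ(x)`. [folklore] -/
theorem fderiv_apply_coord (x h : EuclideanSpace ℝ (Fin 2)) :
    fderiv ℝ Ψ x h = h 0 * fderiv ℝ Ψ x (EuclideanSpace.single 0 1) + h 1 * fderiv ℝ Ψ x (EuclideanSpace.single 1 1) := by
  -- `h = h₀ e₀ + h₁ e₁` (the tree's `Literature.Topology.FourManifolds.SphereGerm.eq_smul_add_smul`, inlined to keep the import closure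
  -- of this analysis file inside Mathlib)
  have hh : h = (h 0) • EuclideanSpace.single (0 : Fin 2) (1 : ℝ) + (h 1) • EuclideanSpace.single (1 : Fin 2) (1 : ℝ) := by
    ext i
    fin_cases i <;> simp
  conv_lhs => rw [hh]
  rw [map_add, map_smul, map_smul, smul_eq_mul, smul_eq_mul]

/-- The coordinate function `x ↦ x₀` has derivative the coordinate projection. [folklore] -/
theorem hasFDerivAt_coord_zero (x : EuclideanSpace ℝ (Fin 2)) :
    HasFDerivAt (fun x' : EuclideanSpace ℝ (Fin 2) => (x' 0 : ℝ))
      (EuclideanSpace.proj (𝕜 := ℝ) (0 : Fin 2) : EuclideanSpace ℝ (Fin 2) →L[ℝ] ℝ) x := by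
  simpa using (EuclideanSpace.proj (𝕜 := ℝ) (0 : Fin 2)).hasFDerivAt

/-- The coordinate function `x ↦ x₁` has derivative the coordinate projection. [folklore] -/
theorem hasFDerivAt_coord_one (x : EuclideanSpace ℝ (Fin 2)) :
    HasFDerivAt (fun x' : EuclideanSpace ℝ (Fin 2) => (x' 1 : ℝ))
      (EuclideanSpace.proj (𝕜 := ℝ) (1 : Fin 2) : EuclideanSpace ℝ (Fin 2) →L[ℝ] ℝ) x := by
  simpa using (EuclideanSpace.proj (𝕜 := ℝ) (1 : Fin 2)).hasFDerivAt

/-- Evaluation of the coordinate projection `0`. [folklore] -/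
theorem proj_zero_apply (v : EuclideanSpace ℝ (Fin 2)) : (EuclideanSpace.proj (𝕜 := ℝ) (0 : Fin 2)) v = v 0 := by simp

/-- Evaluation of the coordinate projection `1`. [folklore] -/
theorem proj_one_apply (v : EuclideanSpace ℝ (Fin 2)) : (EuclideanSpace.proj (𝕜 := ℝ) (1 : Fin 2)) v = v 1 := by simp

/-! ### Rotation orbits -/

/-- **Velocity of a rotation orbit.**  The orbit `c(s) = R_{ωs} y = (cos(ωs) y₀ − sin(ωs) y₁, sin(ωs) y₀ + cos(ωs) y₁)` has velocity
`ω · J(c(s))`, `J y' = (−y'₁, y'₀)` the rotation generator. [folklore] -/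
theorem hasDerivAt_rotOrbit
    (hc : ∀ s, c s = (Real.cos (ω * s) * y 0 - Real.sin (ω * s) * y 1) • EuclideanSpace.single (0 : Fin 2) (1 : ℝ) +
      (Real.sin (ω * s) * y 0 + Real.cos (ω * s) * y 1) • EuclideanSpace.single (1 : Fin 2) (1 : ℝ))
    (hJ : ∀ y' : EuclideanSpace ℝ (Fin 2), J y' = (-(y' 1)) • EuclideanSpace.single (0 : Fin 2) (1 : ℝ) +
      (y' 0) • EuclideanSpace.single (1 : Fin 2) (1 : ℝ))
    (s : ℝ) : HasDerivAt c (ω • J (c s)) s := by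
  have hc' : c = fun s => (Real.cos (ω * s) * y 0 - Real.sin (ω * s) * y 1) • EuclideanSpace.single (0 : Fin 2) (1 : ℝ) +
      (Real.sin (ω * s) * y 0 + Real.cos (ω * s) * y 1) • EuclideanSpace.single (1 : Fin 2) (1 : ℝ) := funext hc
  rw [hJ, hc']
  have hlin : HasDerivAt (fun s : ℝ => ω * s) ω s := by simpa using (hasDerivAt_id s).const_mul ω
  have hcos : HasDerivAt (fun s : ℝ => Real.cos (ω * s)) (-Real.sin (ω * s) * ω) s := (Real.hasDerivAt_cos (ω * s)).comp s hlin
  have hsin : HasDerivAt (fun s : ℝ => Real.sin (ω * s)) (Real.cos (ω * s) * ω) s := (Real.hasDerivAt_sin (ω * s)).comp s hlin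
  have h0 : HasDerivAt (fun s : ℝ => Real.cos (ω * s) * y 0 - Real.sin (ω * s) * y 1)
      (-Real.sin (ω * s) * ω * y 0 - Real.cos (ω * s) * ω * y 1) s := (hcos.mul_const _).sub (hsin.mul_const _)
  have h1 : HasDerivAt (fun s : ℝ => Real.sin (ω * s) * y 0 + Real.cos (ω * s) * y 1)
      (Real.cos (ω * s) * ω * y 0 + -Real.sin (ω * s) * ω * y 1) s := (hsin.mul_const _).add (hcos.mul_const _)
  refine ((h0.smul_const (EuclideanSpace.single (0 : Fin 2) (1 : ℝ))).add
    (h1.smul_const (EuclideanSpace.single (1 : Fin 2) (1 : ℝ)))).congr_deriv ?_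
  ext i
  fin_cases i <;> simp <;> ring

/-- The rotation orbit starts at `y`: `c(0) = y`. [folklore] -/
theorem rotOrbit_zero
    (hc : ∀ s, c s = (Real.cos (ω * s) * y 0 - Real.sin (ω * s) * y 1) • EuclideanSpace.single (0 : Fin 2) (1 : ℝ) +
      (Real.sin (ω * s) * y 0 + Real.cos (ω * s) * y 1) • EuclideanSpace.single (1 : Fin 2) (1 : ℝ)) :
    c 0 = y := by
  rw [hc 0]
  ext i
  fin_cases i <;> simp

/-- The unit-rate rotation orbit is `2π`-periodic. [folklore] -/
theorem rotOrbit_add_two_pi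
    (hc : ∀ s, c s = (Real.cos (1 * s) * y 0 - Real.sin (1 * s) * y 1) • EuclideanSpace.single (0 : Fin 2) (1 : ℝ) +
      (Real.sin (1 * s) * y 0 + Real.cos (1 * s) * y 1) • EuclideanSpace.single (1 : Fin 2) (1 : ℝ))
    (s : ℝ) : c (s + 2 * Real.pi) = c s := by
  rw [hc, hc, one_mul, one_mul, Real.cos_add_two_pi, Real.sin_add_two_pi]

/-- **First derivative along a rotation orbit = `ω ×` the angular derivative.**  For differentiable `Ψ`,
`d/ds Ψ(c s) = ω · DΨ(c s)[J(c s)]`. [folklore] -/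
theorem hasDerivAt_comp_rotOrbit (hΨd : Differentiable ℝ Ψ)
    (hc : ∀ s, c s = (Real.cos (ω * s) * y 0 - Real.sin (ω * s) * y 1) • EuclideanSpace.single (0 : Fin 2) (1 : ℝ) +
      (Real.sin (ω * s) * y 0 + Real.cos (ω * s) * y 1) • EuclideanSpace.single (1 : Fin 2) (1 : ℝ))
    (hJ : ∀ y' : EuclideanSpace ℝ (Fin 2), J y' = (-(y' 1)) • EuclideanSpace.single (0 : Fin 2) (1 : ℝ) +
      (y' 0) • EuclideanSpace.single (1 : Fin 2) (1 : ℝ))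
    (s : ℝ) : HasDerivAt (fun s' => Ψ (c s')) (ω * fderiv ℝ Ψ (c s) (J (c s))) s := by
  have h := (hΨd (c s)).hasFDerivAt.comp_hasDerivAt s (hasDerivAt_rotOrbit hc hJ s)
  rw [map_smul, smul_eq_mul] at h
  exact h

/-- **The angular derivative of a `C²` function is differentiable** (`y' ↦ DΨ(y')[Jy']`). [folklore] -/
theorem differentiable_angularDeriv (hΨ : ContDiff ℝ 2 Ψ)
    (hJ : ∀ y' : EuclideanSpace ℝ (Fin 2), J y' = (-(y' 1)) • EuclideanSpace.single (0 : Fin 2) (1 : ℝ) +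
      (y' 0) • EuclideanSpace.single (1 : Fin 2) (1 : ℝ)) :
    Differentiable ℝ fun y' => fderiv ℝ Ψ y' (J y') := by
  have hJ' : J = fun y' => (-(y' 1)) • EuclideanSpace.single (0 : Fin 2) (1 : ℝ) +
      (y' 0) • EuclideanSpace.single (1 : Fin 2) (1 : ℝ) := funext hJ
  have hJc : ContDiff ℝ 1 J := by
    rw [hJ']
    fun_prop
  have hDΨ : ContDiff ℝ 1 (fderiv ℝ Ψ) := hΨ.fderiv_right (m := 1) le_rfl
  exact (hDΨ.clm_apply hJc).differentiable one_ne_zero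

/-- **Derivative of the angular derivative along a rotation orbit.**  For `C²` `Ψ`,
`d/ds (ΘΨ)(c s) = ω · D(ΘΨ)(c s)[J(c s)]`, `ΘΨ(y') = DΨ(y')[Jy']`. [folklore] -/
theorem hasDerivAt_angularDeriv_comp_rotOrbit (hΨ : ContDiff ℝ 2 Ψ)
    (hc : ∀ s, c s = (Real.cos (ω * s) * y 0 - Real.sin (ω * s) * y 1) • EuclideanSpace.single (0 : Fin 2) (1 : ℝ) +
      (Real.sin (ω * s) * y 0 + Real.cos (ω * s) * y 1) • EuclideanSpace.single (1 : Fin 2) (1 : ℝ))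
    (hJ : ∀ y' : EuclideanSpace ℝ (Fin 2), J y' = (-(y' 1)) • EuclideanSpace.single (0 : Fin 2) (1 : ℝ) +
      (y' 0) • EuclideanSpace.single (1 : Fin 2) (1 : ℝ))
    (s : ℝ) :
    HasDerivAt (fun s' => fderiv ℝ Ψ (c s') (J (c s')))
      (ω * fderiv ℝ (fun y' => fderiv ℝ Ψ y' (J y')) (c s) (J (c s))) s := by
  have h := ((differentiable_angularDeriv hΨ hJ) (c s)).hasFDerivAt.comp_hasDerivAt s (hasDerivAt_rotOrbit hc hJ s)
  rw [map_smul, smul_eq_mul] at h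
  exact h

/-- **Second derivative along a rotation orbit = `ω² ×` the second angular derivative.**  For `C²` `Ψ` and every `s`,
`d²/ds² Ψ(c s) = ω² · (ΘΘΨ)(c s)` with `ΘΘΨ(y') = D(y'' ↦ DΨ(y'')[Jy''])(y')[Jy']`. [folklore] -/
theorem deriv_deriv_comp_rotOrbit (hΨ : ContDiff ℝ 2 Ψ)
    (hc : ∀ s, c s = (Real.cos (ω * s) * y 0 - Real.sin (ω * s) * y 1) • EuclideanSpace.single (0 : Fin 2) (1 : ℝ) +
      (Real.sin (ω * s) * y 0 + Real.cos (ω * s) * y 1) • EuclideanSpace.single (1 : Fin 2) (1 : ℝ))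
    (hJ : ∀ y' : EuclideanSpace ℝ (Fin 2), J y' = (-(y' 1)) • EuclideanSpace.single (0 : Fin 2) (1 : ℝ) +
      (y' 0) • EuclideanSpace.single (1 : Fin 2) (1 : ℝ))
    (s : ℝ) :
    deriv (fun s' => deriv (fun s'' => Ψ (c s'')) s') s =
      ω ^ 2 * fderiv ℝ (fun y' => fderiv ℝ Ψ y' (J y')) (c s) (J (c s)) := by
  have hΨd : Differentiable ℝ Ψ := hΨ.differentiable two_ne_zero
  have hfun : (fun s' => deriv (fun s'' => Ψ (c s'')) s') = fun s' => ω * fderiv ℝ Ψ (c s') (J (c s')) :=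
    funext fun s' => (hasDerivAt_comp_rotOrbit hΨd hc hJ s').deriv
  rw [hfun, ((hasDerivAt_angularDeriv_comp_rotOrbit hΨ hc hJ s).const_mul ω).deriv]
  ring

/-! ### The profile equation of a rotating pattern -/

/-- ★ **The profile equation of a rotating pattern.**  Let `Ψ : ℝ² → ℝ` be `C²` and suppose the rotating pattern
`W s y = Ψ (R_{ωs} y)` satisfies, at height `s = 0` and every `y`, the slice equation in the shape of `…ZShockSliceTyping.slice_wave_pde` /
`…ZShockWaveLocalEnergy.waveEnergy_balance`: `∂ₛ∂ₛW = Σᵢ ∂ᵢ(γ(W) ∂ᵢW)` (with `W 0 = Ψ`).  Then `Ψ` solves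
`ω² ΘΘΨ = Σᵢ ∂ᵢ(γ(Ψ) ∂ᵢΨ)` on the plane, `ΘΨ(y) = DΨ(y)[Jy]`, `Jy = (−y₁, y₀)`. [folklore] -/
theorem rotating_slice_profile_equation (hΨ : ContDiff ℝ 2 Ψ)
    (hJ : ∀ y' : EuclideanSpace ℝ (Fin 2), J y' = (-(y' 1)) • EuclideanSpace.single (0 : Fin 2) (1 : ℝ) +
      (y' 0) • EuclideanSpace.single (1 : Fin 2) (1 : ℝ))
    (hpde : ∀ y : EuclideanSpace ℝ (Fin 2),
      deriv (fun s' => deriv (fun s'' => Ψ ((Real.cos (ω * s'') * y 0 - Real.sin (ω * s'') * y 1) •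
          EuclideanSpace.single (0 : Fin 2) (1 : ℝ) +
        (Real.sin (ω * s'') * y 0 + Real.cos (ω * s'') * y 1) • EuclideanSpace.single (1 : Fin 2) (1 : ℝ))) s') 0 =
        ∑ i, fderiv ℝ (fun y' => γ (Ψ y') * fderiv ℝ Ψ y' (EuclideanSpace.single i 1)) y (EuclideanSpace.single i 1)) :
    ∀ y : EuclideanSpace ℝ (Fin 2),
      ω ^ 2 * fderiv ℝ (fun y' => fderiv ℝ Ψ y' (J y')) y (J y) =
        ∑ i, fderiv ℝ (fun y' => γ (Ψ y') * fderiv ℝ Ψ y' (EuclideanSpace.single i 1)) y (EuclideanSpace.single i 1) := by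
  intro y
  set c : ℝ → EuclideanSpace ℝ (Fin 2) := fun s => (Real.cos (ω * s) * y 0 - Real.sin (ω * s) * y 1) •
      EuclideanSpace.single (0 : Fin 2) (1 : ℝ) +
    (Real.sin (ω * s) * y 0 + Real.cos (ω * s) * y 1) • EuclideanSpace.single (1 : Fin 2) (1 : ℝ) with hc_def
  have hc : ∀ s, c s = (Real.cos (ω * s) * y 0 - Real.sin (ω * s) * y 1) • EuclideanSpace.single (0 : Fin 2) (1 : ℝ) +
      (Real.sin (ω * s) * y 0 + Real.cos (ω * s) * y 1) • EuclideanSpace.single (1 : Fin 2) (1 : ℝ) := fun s => rfl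
  have h := hpde y
  rw [deriv_deriv_comp_rotOrbit hΨ hc hJ 0, rotOrbit_zero hc] at h
  exact h

/-! ### Angular flatness -/

/-- **A periodic function with bounded second derivative has bounded first derivative.**  If `f : ℝ → ℝ` has derivatives `f'`, `f''`
everywhere, `f (α + T) = f α` for all `α` (`T > 0`) and `|f''| ≤ M`, then `|f' β| ≤ M·T` for every `β` (Rolle gives a zero of `f'` in
`(β, β + T)`, then the mean value theorem). [folklore] -/
theorem periodic_deriv_abs_le {f f' f'' : ℝ → ℝ} {T M : ℝ} (hT : 0 < T)
    (hf : ∀ α, HasDerivAt f (f' α) α) (hf' : ∀ α, HasDerivAt f' (f'' α) α)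
    (hper : ∀ α, f (α + T) = f α) (hM : ∀ α, |f'' α| ≤ M) (β : ℝ) : |f' β| ≤ M * T := by
  -- Rolle on `[β, β + T]`
  obtain ⟨α, hα, hα0⟩ : ∃ α ∈ Ioo β (β + T), f' α = 0 :=
    exists_hasDerivAt_eq_zero (by linarith) (fun x _ => (hf x).continuousAt.continuousWithinAt) (hper β).symm
      fun x _ => hf x
  -- mean value theorem for `f'` on `[β, α]`
  obtain ⟨ξ, _, hξ⟩ : ∃ ξ ∈ Ioo β α, f'' ξ = (f' α - f' β) / (α - β) :=
    exists_hasDerivAt_eq_slope f' f'' hα.1 (fun x _ => (hf' x).continuousAt.continuousWithinAt) fun x _ => hf' x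
  have hαβ : 0 < α - β := sub_pos.2 hα.1
  have hkey : f' β = -(f'' ξ * (α - β)) := by
    rw [hξ, div_mul_cancel₀ _ hαβ.ne', hα0]
    ring
  have hM0 : 0 ≤ M := (abs_nonneg _).trans (hM ξ)
  calc |f' β| = |f'' ξ| * (α - β) := by rw [hkey, abs_neg, abs_mul, abs_of_pos hαβ]
    _ ≤ M * T := mul_le_mul (hM ξ) (by linarith [hα.2]) hαβ.le hM0

/-- ★ **Angular flatness.**  Let `Ψ : ℝ² → ℝ` be `C²` with bounded SECOND angular derivative, `|ΘΘΨ(y')| ≤ K` for all `y'`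
(`ΘΨ(y') = DΨ(y')[Jy']`, `Jy' = (−y'₁, y'₀)`).  Then the FIRST angular derivative is bounded: `|DΨ(y)[Jy]| ≤ K · (2π)` at every `y` —
although `|Jy| = |y|` is unbounded.  (Apply `periodic_deriv_abs_le` to `α ↦ Ψ(R_α y)`.) [folklore] -/
theorem angularDeriv_abs_le (hΨ : ContDiff ℝ 2 Ψ)
    (hJ : ∀ y' : EuclideanSpace ℝ (Fin 2), J y' = (-(y' 1)) • EuclideanSpace.single (0 : Fin 2) (1 : ℝ) +
      (y' 0) • EuclideanSpace.single (1 : Fin 2) (1 : ℝ))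
    {K : ℝ} (hK : ∀ y' : EuclideanSpace ℝ (Fin 2), |fderiv ℝ (fun y'' => fderiv ℝ Ψ y'' (J y'')) y' (J y')| ≤ K)
    (y : EuclideanSpace ℝ (Fin 2)) : |fderiv ℝ Ψ y (J y)| ≤ K * (2 * Real.pi) := by
  have hΨd : Differentiable ℝ Ψ := hΨ.differentiable two_ne_zero
  -- the unit-rate orbit of `y`
  set c : ℝ → EuclideanSpace ℝ (Fin 2) := fun s => (Real.cos (1 * s) * y 0 - Real.sin (1 * s) * y 1) •
      EuclideanSpace.single (0 : Fin 2) (1 : ℝ) +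
    (Real.sin (1 * s) * y 0 + Real.cos (1 * s) * y 1) • EuclideanSpace.single (1 : Fin 2) (1 : ℝ) with hc_def
  have hc : ∀ s, c s = (Real.cos (1 * s) * y 0 - Real.sin (1 * s) * y 1) • EuclideanSpace.single (0 : Fin 2) (1 : ℝ) +
      (Real.sin (1 * s) * y 0 + Real.cos (1 * s) * y 1) • EuclideanSpace.single (1 : Fin 2) (1 : ℝ) := fun s => rfl
  have hf : ∀ α, HasDerivAt (fun s' => Ψ (c s')) (fderiv ℝ Ψ (c α) (J (c α))) α := by
    intro α
    have h := hasDerivAt_comp_rotOrbit hΨd hc hJ α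
    rw [one_mul] at h
    exact h
  have hf' : ∀ α, HasDerivAt (fun s' => fderiv ℝ Ψ (c s') (J (c s')))
      (fderiv ℝ (fun y' => fderiv ℝ Ψ y' (J y')) (c α) (J (c α))) α := by
    intro α
    have h := hasDerivAt_angularDeriv_comp_rotOrbit hΨ hc hJ α
    rw [one_mul] at h
    exact h
  have hper : ∀ α, Ψ (c (α + 2 * Real.pi)) = Ψ (c α) := fun α => by rw [rotOrbit_add_two_pi hc]
  have h := periodic_deriv_abs_le Real.two_pi_pos hf hf' hper (fun α => hK (c α)) 0
  rwa [rotOrbit_zero hc] at h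

/-- ★ **Angular flatness of rotating patterns.**  If the `C²` profile `Ψ` solves the rotating-pattern equation
`ω² ΘΘΨ = Σᵢ ∂ᵢ(γ(Ψ)∂ᵢΨ)` (`ω ≠ 0`) and the divergence side is bounded, `|Σᵢ ∂ᵢ(γ(Ψ)∂ᵢΨ)| ≤ C` (in the class: all slice derivatives are
bounded), then `|DΨ(y)[Jy]| ≤ (C/ω²)·2π` for every `y`: the tangential derivative of a rotating pattern decays like `|y|⁻¹`, and the angular
datum of the exterior radius-as-time problem is uniformly bounded. [folklore] -/
theorem angularDeriv_abs_le_of_rotating (hΨ : ContDiff ℝ 2 Ψ) (hω : ω ≠ 0)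
    (hJ : ∀ y' : EuclideanSpace ℝ (Fin 2), J y' = (-(y' 1)) • EuclideanSpace.single (0 : Fin 2) (1 : ℝ) +
      (y' 0) • EuclideanSpace.single (1 : Fin 2) (1 : ℝ))
    (hrot : ∀ y : EuclideanSpace ℝ (Fin 2),
      ω ^ 2 * fderiv ℝ (fun y' => fderiv ℝ Ψ y' (J y')) y (J y) =
        ∑ i, fderiv ℝ (fun y' => γ (Ψ y') * fderiv ℝ Ψ y' (EuclideanSpace.single i 1)) y (EuclideanSpace.single i 1))
    {C : ℝ} (hC : ∀ y : EuclideanSpace ℝ (Fin 2),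
      |∑ i, fderiv ℝ (fun y' => γ (Ψ y') * fderiv ℝ Ψ y' (EuclideanSpace.single i 1)) y (EuclideanSpace.single i 1)| ≤ C)
    (y : EuclideanSpace ℝ (Fin 2)) : |fderiv ℝ Ψ y (J y)| ≤ C / ω ^ 2 * (2 * Real.pi) := by
  have hω2 : 0 < ω ^ 2 := by positivity
  refine angularDeriv_abs_le hΨ hJ (fun y' => ?_) y
  rw [le_div_iff₀ hω2, ← abs_of_pos hω2, ← abs_mul, mul_comm]
  rw [hrot y']
  exact hC y'

end Summit.NavierStokesRegularity.NavierStokesRegularity.Theorems.PoloidalWindowDoorPoloidalWindowRigidityZShockRotatingProfile
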